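import Literature.Computability.Cryptography.TreeSigForgerBricks
import Literature.Computability.Cryptography.TreeSigHybrid
import Literature.Computability.Complexity.OracleOneQuery
import HarnessLib

/-!
# The authentication-tree scheme, XII: the one-time forger — programs

Topic `Literature/Computability/Cryptography`; the one-time forger `B` of Goldreich's reduction (proof of
Prop. 6.4.15, Steps 1–4, in the lazy form of Prop. 6.4.17) as string functions in `FP`, over the emulation
infrastructure of `TreeSigDistinguisher.lean`. On input `⟨1ⁿ, pk_e⟩` (an external one-time verification key) and
coins `r_B = r ‖ w ‖ tb ‖ …`, `B` recomputes the lazily sampled node blocks from the supply string `w` (first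
occurrences of label codes, `TabWFn`), plants `pk_e` at the label of the slot `t = ⟦tb⟧` (`pkFB`), and emulates the
tree forger `𝒜` against the hybrid signer whose planted node answers a CONSTANT string `v` (`sgFB`, `ansB`, `resB`):
first with `v = ε` to find the one message `m⋆` the planted node must sign (`QB`) and whether it must (`DB`), then —
after one query to its signing oracle — with `v` the external signature, cutting the forged signature at the planted
level (`outB`). This file: the ENVIRONMENT record `⟨1ⁿ, ⟨⟨⟨1ⁿ, pk_e⟩, r_B⟩, v⟩⟩` and its accessors, `TabWFn`, the hybrid
node bricks, the emulation pieces, with their values (`…_apply`) and membership in `FP`.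

All proved; no named facts.

## References

* O. Goldreich, *Foundations of Cryptography II*, CUP 2004, §6.4.2.2, proof of Prop. 6.4.15 ("The construction of
  adversary `A`", Steps 1–4); §6.4.2.3, Prop. 6.4.17.
* S. Arora, B. Barak, *Computational Complexity*, CUP 2009, §1.3, §3.4.
-/

namespace Literature.Computability.Cryptography

open _root_.Computability Complexity Complexity.Brick Polynomial
open Complexity.Plumb Complexity.OracleCompose Complexity.HashBricks Complexity.OracleAlg

namespace TreeSig

variable (P : Spec) (𝒜 : OracleAdversary (List Bool × List Bool))

/-! ### Decoding the forger's coins -/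

/-- The supply length `fuelD(n) · R(n)`. [folklore] -/
noncomputable def mRPoly : Polynomial ℕ := fuelD P 𝒜 * P.R

/-- The number of slot bits: the binary length of `NSlot(n) = qD(n)`. [folklore] -/
noncomputable def kS (n : ℕ) : ℕ := (encodeNat ((qD P 𝒜).eval n)).length

/-- `qD(n)` is the number of slots. [folklore] -/
theorem qD_eval_NSlot (n : ℕ) : (qD P 𝒜).eval n = NSlot n (TA P 𝒜 n) := by rw [qD_eval, NSlot]

/-- The distinguisher part `r` of the coins. [folklore] -/
noncomputable def rOfB (n : ℕ) (rB : List Bool) : List Bool := rB.take ((cDPoly P 𝒜).eval n)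

/-- The supply string `w`. [folklore] -/
noncomputable def wOfB (n : ℕ) (rB : List Bool) : List Bool := (rB.drop ((cDPoly P 𝒜).eval n)).take ((mRPoly P 𝒜).eval n)

/-- The slot bits `tb`. [folklore] -/
noncomputable def tbOfB (n : ℕ) (rB : List Bool) : List Bool := (rB.drop ((cDPoly P 𝒜).eval n + (mRPoly P 𝒜).eval n)).take (kS P 𝒜 n)

/-- The slot `t = min ⟦tb⟧ NSlot(n)` (slots `≥ NSlot` are invalid; the forger then plants nowhere useful). [folklore] -/
noncomputable def tOfB (n : ℕ) (rB : List Bool) : ℕ := min (bitsToNat (tbOfB P 𝒜 n rB)) ((qD P 𝒜).eval n)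

/-- **The environment record** `⟨1ⁿ, ⟨⟨⟨1ⁿ, pk_e⟩, r_B⟩, v⟩⟩` of the node bricks. [folklore] -/
def envB (n : ℕ) (pk rB v : List Bool) : List Bool := boolPair (ones n) (boolPair (boolPair (boolPair (unaryEncodeNat n) pk) rB) v)

/-! ### Accessors of the environment -/

/-- `1ⁿ`. [folklore] -/ noncomputable def snF : List Bool → List Bool := fstF
/-- `pk_e`. [folklore] -/ noncomputable def spkeF : List Bool → List Bool := sndF ∘ fstF ∘ fstF ∘ sndF
/-- `r_B`. [folklore] -/ noncomputable def srBF : List Bool → List Bool := sndF ∘ fstF ∘ sndF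
/-- `v`. [folklore] -/ noncomputable def svF : List Bool → List Bool := sndF ∘ sndF
/-- `r`. [folklore] -/ noncomputable def srF : List Bool → List Bool := takeFn ∘ fanoutFn (polyFn (cDPoly P 𝒜) ∘ snF) srBF
/-- `⟨1ⁿ, r⟩`. [folklore] -/ noncomputable def snrF : List Bool → List Bool := fanoutFn snF (srF P 𝒜)
/-- `w`. [folklore] -/ noncomputable def swF : List Bool → List Bool :=
  takeFn ∘ fanoutFn (polyFn (mRPoly P 𝒜) ∘ snF) (dropFn ∘ fanoutFn (polyFn (cDPoly P 𝒜) ∘ snF) srBF)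
/-- `tb`. [folklore] -/ noncomputable def stbF : List Bool → List Bool :=
  takeFn ∘ fanoutFn (onesFn ∘ lenBinF ∘ polyFn (qD P 𝒜) ∘ snF) (dropFn ∘ fanoutFn (polyFn (cDPoly P 𝒜 + mRPoly P 𝒜) ∘ snF) srBF)
/-- `1ᵗ`. [folklore] -/ noncomputable def stF : List Bool → List Bool := binToUnaryFn ∘ fanoutFn (polyFn (qD P 𝒜) ∘ snF) (stbF P 𝒜)
/-- `L_t`. [folklore] -/ noncomputable def sLtF : List Bool → List Bool := qlabF P 𝒜 ∘ fanoutFn (snrF P 𝒜) (stF P 𝒜)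
/-- `listBool [code n (labAt j) : j < nFetch]`. [folklore] -/ noncomputable def sCodesF : List Bool → List Bool :=
  tabulateFn (QD P 𝒜 ∘ fanoutFn (sndF ∘ fstF) sndF) 4 ∘ fanoutFn (polyFn (qD P 𝒜) ∘ snrF P 𝒜) (snrF P 𝒜)

variable {P 𝒜}

section Apply

variable (n : ℕ) (pk rB v : List Bool)

/-- `snF_env` (bookkeeping). [folklore] -/
theorem snF_env : snF (envB n pk rB v) = ones n := fstF_boolPair _ _
/-- `spkeF_env` (bookkeeping). [folklore] -/
theorem spkeF_env : spkeF (envB n pk rB v) = pk := by simp [spkeF, envB]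
/-- `srBF_env` (bookkeeping). [folklore] -/
theorem srBF_env : srBF (envB n pk rB v) = rB := by simp [srBF, envB]
/-- `svF_env` (bookkeeping). [folklore] -/
theorem svF_env : svF (envB n pk rB v) = v := by simp [svF, envB]
/-- `srF_env` (bookkeeping). [folklore] -/
theorem srF_env : srF P 𝒜 (envB n pk rB v) = rOfB P 𝒜 n rB := by
  simp [srF, snF_env, srBF_env, rOfB, ones]
/-- `snrF_env` (bookkeeping). [folklore] -/
theorem snrF_env : snrF P 𝒜 (envB n pk rB v) = boolPair (unaryEncodeNat n) (rOfB P 𝒜 n rB) := by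
  rw [snrF, fanoutFn_apply, snF_env, srF_env, Complexity.unaryEncodeNat_eq_replicate, ones]
/-- `swF_env` (bookkeeping). [folklore] -/
theorem swF_env : swF P 𝒜 (envB n pk rB v) = wOfB P 𝒜 n rB := by
  simp [swF, snF_env, srBF_env, wOfB, ones]
/-- `stbF_env` (bookkeeping). [folklore] -/
theorem stbF_env : stbF P 𝒜 (envB n pk rB v) = tbOfB P 𝒜 n rB := by
  simp [stbF, snF_env, srBF_env, tbOfB, kS, ones, lenBinF_apply, onesFn, Complexity.unaryEncodeNat_eq_replicate, eval_add]
/-- `stF_env` (bookkeeping). [folklore] -/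
theorem stF_env : stF P 𝒜 (envB n pk rB v) = ones (tOfB P 𝒜 n rB) := by
  rw [stF, Function.comp_apply, fanoutFn_apply, Function.comp_apply, snF_env, polyFn_apply, stbF_env, binToUnaryFn_boolPair, tOfB]
  simp [ones]
/-- `sLtF_env` (bookkeeping). [folklore] -/
theorem sLtF_env : sLtF P 𝒜 (envB n pk rB v) = Lslot P 𝒜 n (rOfB P 𝒜 n rB) (tOfB P 𝒜 n rB) := by
  rw [sLtF, Function.comp_apply, fanoutFn_apply, snrF_env, stF_env, ones, qlabF_apply, Lslot]

/-- The label codes of the fetch rounds. [folklore] -/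
noncomputable def codesOf (n : ℕ) (r : List Bool) : List (List Bool) :=
  (List.range (nFetch P 𝒜 n r)).map fun j => code n (labAt n (ρD P 𝒜 n r) j)

/-- `sCodesF_env` (bookkeeping). [folklore] -/
theorem sCodesF_env : sCodesF P 𝒜 (envB n pk rB v) = encList (codesOf (P := P) (𝒜 := 𝒜) n (rOfB P 𝒜 n rB)) := by
  rw [sCodesF, Function.comp_apply, fanoutFn_apply, Function.comp_apply, snrF_env, polyFn_apply]
  rw [tabulateFn_apply]
  · rw [codesOf, nFetch, List.length_replicate]
    refine congrArg encList (List.map_congr_left fun j _ => ?_)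
    rw [Function.comp_apply, fanoutFn_apply, Function.comp_apply, fstF_boolPair, sndF_boolPair, sndF_boolPair, ones, QD_apply]
  · intro j _
    rw [Function.comp_apply, fanoutFn_apply, Function.comp_apply, fstF_boolPair, sndF_boolPair, sndF_boolPair, ones, QD_apply,
      length_boolPair, length_boolPair, List.length_replicate]
    have h1 : (code n (labAt n (ρD P 𝒜 n (rOfB P 𝒜 n rB)) j)).length ≤ (labAt n (ρD P 𝒜 n (rOfB P 𝒜 n rB)) j).length + n + 1 := by
      simp only [code, List.length_append, List.length_cons, List.length_replicate]; omega
    have h2 : (labAt n (ρD P 𝒜 n (rOfB P 𝒜 n rB)) j).length ≤ n + 1 := by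
      rcases Nat.eq_zero_or_pos n with rfl | hn
      · simp only [labAt]; split_ifs <;> simp [Yao.blk]
      · exact (length_labAt_le n _ j hn).trans (Nat.le_succ n)
    simp only [Complexity.unaryEncodeNat_eq_replicate, List.length_replicate]
    nlinarith

end Apply

/-! ### The block assignment brick -/

section TabWBrick

variable (P 𝒜)

/-- The code of the label, `code n L`. [folklore] -/ noncomputable def tcodeF : List Bool → List Bool := pad10Fn ∘ fanoutFn (snF ∘ fstF) sndF
/-- `1^{first fetch round of the label}`. [folklore] -/ noncomputable def tjF : List Bool → List Bool := firstIdxFn ∘ fanoutFn (tcodeF) (sCodesF P 𝒜 ∘ fstF)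
/-- Block extraction `⟨1ᴿ, ⟨1ʲ, w⟩⟩ ↦ blk R j w` (the brick of `LamportOTS.lean`, not imported here). [folklore] -/
noncomputable def ublkFn : List Bool → List Bool := takeFn ∘ fanoutFn fstF (dropFn ∘ fanoutFn (umulFn ∘ fanoutFn (nthF 1) fstF) (sndPow 1))
/-- The supply block of the label. [folklore] -/ noncomputable def tblkF : List Bool → List Bool :=
  ublkFn ∘ fanoutFn (polyFn P.R ∘ snF ∘ fstF) (fanoutFn (tjF P 𝒜) (swF P 𝒜 ∘ fstF))
/-- The fitted block. [folklore] -/ noncomputable def tfitF : List Bool → List Bool := fitLenFn ∘ fanoutFn (polyFn P.R ∘ snF ∘ fstF) (tblkF P 𝒜)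
/-- **The block assignment of the supply string**: `⟨s, L⟩ ↦ TabW n r w L`. [Goldreich 2001, Thm. 3.6.6 (proof)] [folklore] -/
noncomputable def TabWFn : List Bool → List Bool := iteFn (lenLeFn X ∘ fanoutFn (snF ∘ fstF) sndF) (tfitF P 𝒜) fun _ => []

variable {P 𝒜}

/-- `ublkFn_apply` (bookkeeping). [folklore] -/
@[simp] theorem ublkFn_apply (u v w : List Bool) : ublkFn (boolPair u (boolPair v w)) = Yao.blk u.length v.length w := by
  simp [ublkFn, umulFn_apply, Yao.blk_eq_take_drop, nthF, sndPow]

/-- `ublkFn_mem_FP` (bookkeeping). [folklore] -/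
theorem ublkFn_mem_FP : ublkFn ∈ FP :=
  comp_mem_FP takeFn_mem_FP (fanoutFn_mem_FP fstF_mem_FP (comp_mem_FP dropFn_mem_FP
    (fanoutFn_mem_FP (comp_mem_FP umulFn_mem_FP (fanoutFn_mem_FP (nthF_mem_FP 1) fstF_mem_FP)) (sndPow_mem_FP 1))))

/-- Keys of the table specification as a function of the code. [folklore] -/
theorem tspec_key_eq {n R : ℕ} (q : List Bool) : (tspec n R).key q = if h : q.length = n + 1 then some ⟨q, h⟩ else none := rfl

/-- `fIdx` over the keys of a list of codes is `firstIdx` over the codes. [folklore] -/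
theorem fIdx_map_key {n R : ℕ} (κ : List.Vector Bool (n + 1)) : ∀ cs : List (List Bool),
    fIdx κ (cs.map (tspec n R).key) = firstIdx κ.toList cs
  | [] => by simp [fIdx, firstIdx]
  | q :: cs => by
    rw [List.map_cons, fIdx, fIdx_map_key κ cs]
    have hiff : (tspec n R).key q = some κ ↔ q = κ.toList := by
      rw [tspec_key_eq]
      split_ifs with h
      · constructor
        · intro h'; cases h'; rfl
        · intro h'; subst h'; rfl
      · constructor
        · intro h'; cases h'
        · intro h'; exact absurd (h'.symm ▸ κ.toList_length) h
    by_cases hq : q = κ.toList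
    · rw [if_pos (hiff.2 hq), firstIdx, List.idxOf_cons_eq _ hq]
    · rw [if_neg (fun h => hq (hiff.1 h)), firstIdx, firstIdx, List.idxOf_cons_ne _ hq]

/-- `keysD` is the list of keys of the codes. [folklore] -/
theorem keysD_eq_map (n : ℕ) (r : List Bool) : keysD P 𝒜 n r = (codesOf (P := P) (𝒜 := 𝒜) n r).map (tspec n (P.R.eval n)).key := by
  rw [keysD, codesOf, List.map_map]; rfl

variable (n : ℕ) (pk rB v : List Bool)

/-- `tcodeF_env` (bookkeeping). [folklore] -/
theorem tcodeF_env (L : List Bool) : tcodeF (boolPair (envB n pk rB v) L) = code n L := by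
  rw [tcodeF, Function.comp_apply, fanoutFn_apply, Function.comp_apply, fstF_boolPair, snF_env, sndF_boolPair, pad10Fn_boolPair, code]

/-- `tjF_env` (bookkeeping). [folklore] -/
theorem tjF_env (L : List Bool) : tjF P 𝒜 (boolPair (envB n pk rB v) L) = ones (firstIdx (code n L) (codesOf (P := P) (𝒜 := 𝒜) n (rOfB P 𝒜 n rB))) := by
  rw [tjF, Function.comp_apply, fanoutFn_apply, tcodeF_env, Function.comp_apply, fstF_boolPair, sCodesF_env, firstIdxFn_apply]

/-- **`TabWFn` computes `TabW`.** [folklore] -/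
theorem TabWFn_env (L : List Bool) : TabWFn P 𝒜 (boolPair (envB n pk rB v) L) = TabW P 𝒜 n (rOfB P 𝒜 n rB) (wOfB P 𝒜 n rB) L := by
  have hc : (lenLeFn X ∘ fanoutFn (snF ∘ fstF) sndF) (boolPair (envB n pk rB v) L) = [decide (L.length ≤ n)] := by
    rw [Function.comp_apply, fanoutFn_apply, Function.comp_apply, fstF_boolPair, snF_env, sndF_boolPair, lenLeFn_boolPair, eval_X, ones,
      List.length_replicate]
  rw [TabWFn, iteFn_apply hc, TabW, tspec_key_eq]
  by_cases hL : L.length ≤ n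
  · have hlen : (code n L).length = n + 1 := length_code hL
    rw [decide_eq_true hL, if_pos rfl, dif_pos hlen]
    dsimp only
    rw [tfitF, Function.comp_apply, fanoutFn_apply, Function.comp_apply, Function.comp_apply, fstF_boolPair, snF_env, polyFn_apply, ones,
      List.length_replicate, tblkF, Function.comp_apply, fanoutFn_apply, Function.comp_apply, Function.comp_apply, fstF_boolPair, snF_env,
      polyFn_apply, List.length_replicate, fanoutFn_apply, tjF_env, Function.comp_apply, fstF_boolPair, swF_env, ublkFn_apply,
      List.length_replicate, List.length_replicate, fitLenFn_boolPair, List.length_replicate, keysD_eq_map, fIdx_map_key]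
    rfl
  · rw [decide_eq_false hL, dif_neg (by rw [code, List.length_append, List.length_cons, List.length_replicate]; omega)]
    simp

/-- `tcodeF_mem_FP` (bookkeeping). [folklore] -/
theorem tcodeF_mem_FP : tcodeF ∈ FP := comp_mem_FP pad10Fn_mem_FP (fanoutFn_mem_FP (comp_mem_FP fstF_mem_FP fstF_mem_FP) sndF_mem_FP)

variable (P 𝒜)

/-- `srF_mem_FP` (bookkeeping). [folklore] -/
theorem srF_mem_FP : srF P 𝒜 ∈ FP := comp_mem_FP takeFn_mem_FP (fanoutFn_mem_FP (comp_mem_FP (polyFn_mem_FP _) fstF_mem_FP)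
  (comp_mem_FP sndF_mem_FP (comp_mem_FP fstF_mem_FP sndF_mem_FP)))
/-- `snrF_mem_FP` (bookkeeping). [folklore] -/
theorem snrF_mem_FP : snrF P 𝒜 ∈ FP := fanoutFn_mem_FP fstF_mem_FP (srF_mem_FP P 𝒜)
/-- `swF_mem_FP` (bookkeeping). [folklore] -/
theorem swF_mem_FP : swF P 𝒜 ∈ FP := comp_mem_FP takeFn_mem_FP (fanoutFn_mem_FP (comp_mem_FP (polyFn_mem_FP _) fstF_mem_FP)
  (comp_mem_FP dropFn_mem_FP (fanoutFn_mem_FP (comp_mem_FP (polyFn_mem_FP _) fstF_mem_FP) (comp_mem_FP sndF_mem_FP (comp_mem_FP fstF_mem_FP sndF_mem_FP)))))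
/-- `stbF_mem_FP` (bookkeeping). [folklore] -/
theorem stbF_mem_FP : stbF P 𝒜 ∈ FP := comp_mem_FP takeFn_mem_FP (fanoutFn_mem_FP
  (comp_mem_FP onesFn_mem_FP (comp_mem_FP lenBinF_mem_FP (comp_mem_FP (polyFn_mem_FP _) fstF_mem_FP)))
  (comp_mem_FP dropFn_mem_FP (fanoutFn_mem_FP (comp_mem_FP (polyFn_mem_FP _) fstF_mem_FP) (comp_mem_FP sndF_mem_FP (comp_mem_FP fstF_mem_FP sndF_mem_FP)))))
/-- `stF_mem_FP` (bookkeeping). [folklore] -/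
theorem stF_mem_FP : stF P 𝒜 ∈ FP := comp_mem_FP binToUnaryFn_mem_FP (fanoutFn_mem_FP (comp_mem_FP (polyFn_mem_FP _) fstF_mem_FP) (stbF_mem_FP P 𝒜))
/-- `sLtF_mem_FP` (bookkeeping). [folklore] -/
theorem sLtF_mem_FP : sLtF P 𝒜 ∈ FP := comp_mem_FP (qlabF_mem_FP P 𝒜) (fanoutFn_mem_FP (snrF_mem_FP P 𝒜) (stF_mem_FP P 𝒜))
/-- `sCodesF_mem_FP` (bookkeeping). [folklore] -/
theorem sCodesF_mem_FP : sCodesF P 𝒜 ∈ FP :=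
  comp_mem_FP (tabulateFn_mem_FP _ (comp_mem_FP (QD_mem_FP P 𝒜) (fanoutFn_mem_FP (comp_mem_FP sndF_mem_FP fstF_mem_FP) sndF_mem_FP)) 4)
    (fanoutFn_mem_FP (comp_mem_FP (polyFn_mem_FP _) (snrF_mem_FP P 𝒜)) (snrF_mem_FP P 𝒜))
/-- `tjF_mem_FP` (bookkeeping). [folklore] -/
theorem tjF_mem_FP : tjF P 𝒜 ∈ FP := comp_mem_FP firstIdxFn_mem_FP (fanoutFn_mem_FP tcodeF_mem_FP (comp_mem_FP (sCodesF_mem_FP P 𝒜) fstF_mem_FP))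
/-- `tblkF_mem_FP` (bookkeeping). [folklore] -/
theorem tblkF_mem_FP : tblkF P 𝒜 ∈ FP := comp_mem_FP ublkFn_mem_FP (fanoutFn_mem_FP (comp_mem_FP (polyFn_mem_FP _) (comp_mem_FP fstF_mem_FP fstF_mem_FP))
  (fanoutFn_mem_FP (tjF_mem_FP P 𝒜) (comp_mem_FP (swF_mem_FP P 𝒜) fstF_mem_FP)))
/-- `tfitF_mem_FP` (bookkeeping). [folklore] -/
theorem tfitF_mem_FP : tfitF P 𝒜 ∈ FP := comp_mem_FP fitLenFn_mem_FP (fanoutFn_mem_FP (comp_mem_FP (polyFn_mem_FP _) (comp_mem_FP fstF_mem_FP fstF_mem_FP)) (tblkF_mem_FP P 𝒜))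
/-- `TabWFn ∈ FP`. [folklore] -/
theorem TabWFn_mem_FP : TabWFn P 𝒜 ∈ FP :=
  iteFn_mem_FP (comp_mem_FP (lenLeFn_mem_FP X) (fanoutFn_mem_FP (comp_mem_FP fstF_mem_FP fstF_mem_FP) sndF_mem_FP)) (tfitF_mem_FP P 𝒜) (const_mem_FP _)

end TabWBrick

/-! ### The hybrid node bricks -/

section Nodes

variable (P 𝒜)

/-- **The hybrid node keys**: the external key at the planted label, else the key of the supply block.
[Goldreich 2004, proof of Prop. 6.4.15, Step 3 ("A uses the verification key `v`" at the `j`-th instance)] [folklore] -/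
noncomputable def pkFB : List Bool → List Bool :=
  iteFn (eqPairFn ∘ fanoutFn sndF (sLtF P 𝒜 ∘ fstF)) (spkeF ∘ fstF) (pkF₀ P (TabWFn P 𝒜))

/-- **The hybrid node signers**: the constant `v` at the planted label, else the signer of the supply block.
[Goldreich 2004, proof of Prop. 6.4.15, Step 3 ("A queries `S_s` for it")] [folklore] -/
noncomputable def sgFB : List Bool → List Bool :=
  iteFn (eqPairFn ∘ fanoutFn (fstF ∘ sndF) (sLtF P 𝒜 ∘ fstF)) (svF ∘ fstF) (sgF₀ P (TabWFn P 𝒜))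

variable {P 𝒜}

variable (n : ℕ) {c : List Bool} (rB v : List Bool)

/-- **`pkFB` computes the hybrid keys `pkH`.** [folklore] -/
theorem pkFB_env (L : List Bool) :
    pkFB P 𝒜 (boolPair (envB n (P.S.keyGen.run n c).1 rB v) L) = pkH P 𝒜 n (rOfB P 𝒜 n rB) (wOfB P 𝒜 n rB) (tOfB P 𝒜 n rB) c L := by
  have hcnd : (eqPairFn ∘ fanoutFn sndF (sLtF P 𝒜 ∘ fstF)) (boolPair (envB n (P.S.keyGen.run n c).1 rB v) L) =
      [decide (L = Lslot P 𝒜 n (rOfB P 𝒜 n rB) (tOfB P 𝒜 n rB))] := by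
    rw [Function.comp_apply, fanoutFn_apply, sndF_boolPair, Function.comp_apply, fstF_boolPair, sLtF_env, eqPairFn_boolPair]
  rw [pkFB, iteFn_apply hcnd, pkH]
  by_cases hL : L = Lslot P 𝒜 n (rOfB P 𝒜 n rB) (tOfB P 𝒜 n rB)
  · rw [decide_eq_true hL, if_pos rfl, hL, Function.update_self, Function.comp_apply, fstF_boolPair, spkeF_env]
  · rw [decide_eq_false hL, Function.update_of_ne hL, pkNW]
    simp only [Bool.false_eq_true, if_false]
    rw [pkF₀_apply, TabWFn_env]
    simp [envB, ones]

/-- **`sgFB` computes the hybrid signers with the constant answer `v`.** [folklore] -/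
theorem sgFB_env (pk L m : List Bool) :
    sgFB P 𝒜 (boolPair (envB n pk rB v) (boolPair L m)) =
      Function.update (sgNW P 𝒜 n (rOfB P 𝒜 n rB) (wOfB P 𝒜 n rB)) (Lslot P 𝒜 n (rOfB P 𝒜 n rB) (tOfB P 𝒜 n rB)) (fun _ => v) L m := by
  have hcnd : (eqPairFn ∘ fanoutFn (fstF ∘ sndF) (sLtF P 𝒜 ∘ fstF)) (boolPair (envB n pk rB v) (boolPair L m)) =
      [decide (L = Lslot P 𝒜 n (rOfB P 𝒜 n rB) (tOfB P 𝒜 n rB))] := by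
    rw [Function.comp_apply, fanoutFn_apply, Function.comp_apply, sndF_boolPair, fstF_boolPair, Function.comp_apply, fstF_boolPair, sLtF_env,
      eqPairFn_boolPair]
  rw [sgFB, iteFn_apply hcnd]
  by_cases hL : L = Lslot P 𝒜 n (rOfB P 𝒜 n rB) (tOfB P 𝒜 n rB)
  · rw [decide_eq_true hL, if_pos rfl, hL, Function.update_self, Function.comp_apply, fstF_boolPair, svF_env]
  · rw [decide_eq_false hL, Function.update_of_ne hL, sgNW]
    simp only [Bool.false_eq_true, if_false]
    rw [sgF₀_apply, TabWFn_env]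
    simp [envB, ones]

variable (P 𝒜)

/-- `pkFB_mem_FP` (bookkeeping). [folklore] -/
theorem pkFB_mem_FP (hK : P.S.keyGen.IsPolyTime unaryEncodeNat pairCode) : pkFB P 𝒜 ∈ FP :=
  iteFn_mem_FP (comp_mem_FP eqPairFn_mem_FP (fanoutFn_mem_FP sndF_mem_FP (comp_mem_FP (sLtF_mem_FP P 𝒜) fstF_mem_FP)))
    (comp_mem_FP (comp_mem_FP sndF_mem_FP (comp_mem_FP fstF_mem_FP (comp_mem_FP fstF_mem_FP sndF_mem_FP))) fstF_mem_FP)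
    (pkF₀_mem_FP P _ (TabWFn_mem_FP P 𝒜) hK)

/-- `sgFB_mem_FP` (bookkeeping). [folklore] -/
theorem sgFB_mem_FP (hK : P.S.keyGen.IsPolyTime unaryEncodeNat pairCode) (hSg : P.S.sign.IsPolyTime pairCode id) : sgFB P 𝒜 ∈ FP :=
  iteFn_mem_FP (comp_mem_FP eqPairFn_mem_FP (fanoutFn_mem_FP (comp_mem_FP fstF_mem_FP sndF_mem_FP) (comp_mem_FP (sLtF_mem_FP P 𝒜) fstF_mem_FP)))
    (comp_mem_FP (comp_mem_FP sndF_mem_FP sndF_mem_FP) fstF_mem_FP)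
    (sgF₀_mem_FP P _ (TabWFn_mem_FP P 𝒜) hK hSg)

end Nodes

/-! ### The emulation of the tree forger against the hybrid signer -/

section Emul

variable (P 𝒜)

/-- `1ⁿ` read off the emulation input `W = ⟨⟨⟨1ⁿ, pk_e⟩, r_B⟩, v⟩`. [folklore] -/ noncomputable def bnF : List Bool → List Bool := onesFn ∘ fstF ∘ fstF ∘ fstF
/-- The environment `⟨1ⁿ, W⟩`. [folklore] -/ noncomputable def bsF : List Bool → List Bool := fanoutFn bnF id
/-- `r`. [folklore] -/ noncomputable def brF : List Bool → List Bool := srF P 𝒜 ∘ bsF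
/-- `ρ = r ⇂ cA(n)`. [folklore] -/ noncomputable def bρF : List Bool → List Bool := dropFn ∘ fanoutFn (polyFn (cAPoly P 𝒜) ∘ bnF) (brF P 𝒜)
/-- `r_A = r ↾ cA(n)`. [folklore] -/ noncomputable def brAF : List Bool → List Bool := takeFn ∘ fanoutFn (polyFn (cAPoly P 𝒜) ∘ bnF) (brF P 𝒜)
/-- The root key `pkH ε`. [folklore] -/ noncomputable def bpk0F : List Bool → List Bool := pkFB P 𝒜 ∘ fanoutFn (bsF) fun _ => []
/-- `1^{PK(n) - |pk_ε|}`. [folklore] -/ noncomputable def bpadF : List Bool → List Bool := dropFn ∘ fanoutFn (bpk0F P 𝒜) (polyFn P.PK ∘ bnF)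
/-- The padded root key `pk'`. [folklore] -/ noncomputable def bpkTF : List Bool → List Bool :=
  fanoutFn bnF (fanoutFn (bpk0F P 𝒜) (Kannan.zerosFn ∘ appF ∘ fanoutFn (bpadF P 𝒜) (bpadF P 𝒜)))
/-- **The tree forger's input** `⟨⟨1ⁿ, pk'⟩, r_A⟩` in the emulation. [Goldreich 2004, proof of Prop. 6.4.15, Step 2] [folklore] -/
noncomputable def preB : List Bool → List Bool := fanoutFn (fanoutFn bnF (bpkTF P 𝒜)) (brAF P 𝒜)
/-- The leaf of path `i`, `blk n i ρ`, from the answering record `⟨W, ⟨1ⁱ, α⟩⟩`. [folklore] -/ noncomputable def bσF : List Bool → List Bool :=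
  ublkFn ∘ fanoutFn (bnF ∘ fstF) (fanoutFn (onesFn ∘ fstF ∘ sndF) (bρF P 𝒜 ∘ fstF))
/-- **The answering rule of the emulation**: the `i`-th query `α` is answered by `⟨α, hybrid signature of α at the leaf
`blk n i ρ`⟩` (pieces clipped at `Pc`). [Goldreich 2004, proof of Prop. 6.4.15, Step 3] [folklore] -/
noncomputable def ansB (Pc : Polynomial ℕ) : List Bool → List Bool :=
  fanoutFn (sndF ∘ sndF) (chainFn (pkFB P 𝒜) (sgFB P 𝒜) Pc ∘ fanoutFn (fanoutFn (bsF ∘ fstF) (sndF ∘ sndF)) (bσF P 𝒜))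
/-- **The result of the emulation** `⟨w_out, listBool records⟩`. [folklore] -/
noncomputable def resB (Pc c R : Polynomial ℕ) : List Bool → List Bool := simFn (EM 𝒜) (preB P 𝒜) (ansB P 𝒜 Pc) c R

variable {P 𝒜}

/-- The emulation input of the one-time forger on `⟨1ⁿ, pk⟩`, coins `r_B`, planted answer `v`. [folklore] -/
def WB (n : ℕ) (pk rB v : List Bool) : List Bool := boolPair (boolPair (boolPair (unaryEncodeNat n) pk) rB) v

variable (n : ℕ) (pk rB v : List Bool)

/-- `bnF_WB` (bookkeeping). [folklore] -/
theorem bnF_WB : bnF (WB n pk rB v) = ones n := by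
  simp [bnF, WB, onesFn, Complexity.unaryEncodeNat_eq_replicate, ones]
/-- `bsF_WB` (bookkeeping). [folklore] -/
theorem bsF_WB : bsF (WB n pk rB v) = envB n pk rB v := by rw [bsF, fanoutFn_apply, bnF_WB]; rfl
/-- `brF_WB` (bookkeeping). [folklore] -/
theorem brF_WB : brF P 𝒜 (WB n pk rB v) = rOfB P 𝒜 n rB := by rw [brF, Function.comp_apply, bsF_WB, srF_env]
/-- `bρF_WB` (bookkeeping). [folklore] -/
theorem bρF_WB : bρF P 𝒜 (WB n pk rB v) = ρD P 𝒜 n (rOfB P 𝒜 n rB) := by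
  rw [bρF, Function.comp_apply, fanoutFn_apply, Function.comp_apply, bnF_WB, polyFn_apply, brF_WB, dropFn_boolPair, ρD, cA_eq]
  simp [ones]
/-- `brAF_WB` (bookkeeping). [folklore] -/
theorem brAF_WB : brAF P 𝒜 (WB n pk rB v) = rA P 𝒜 n (rOfB P 𝒜 n rB) := by
  rw [brAF, Function.comp_apply, fanoutFn_apply, Function.comp_apply, bnF_WB, polyFn_apply, brF_WB, takeFn_boolPair, rA, cA_eq]
  simp [ones]

variable {c : List Bool}

/-- `bpk0F_WB` (bookkeeping). [folklore] -/
theorem bpk0F_WB : bpk0F P 𝒜 (WB n (P.S.keyGen.run n c).1 rB v) = pkH P 𝒜 n (rOfB P 𝒜 n rB) (wOfB P 𝒜 n rB) (tOfB P 𝒜 n rB) c [] := by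
  rw [bpk0F, Function.comp_apply, fanoutFn_apply, bsF_WB, pkFB_env]

/-- `bpkTF_WB` (bookkeeping). [folklore] -/
theorem bpkTF_WB : bpkTF P 𝒜 (WB n (P.S.keyGen.run n c).1 rB v) = pkT P n (pkH P 𝒜 n (rOfB P 𝒜 n rB) (wOfB P 𝒜 n rB) (tOfB P 𝒜 n rB) c []) := by
  have hpad : bpadF P 𝒜 (WB n (P.S.keyGen.run n c).1 rB v) =
      ones (P.PK.eval n - (pkH P 𝒜 n (rOfB P 𝒜 n rB) (wOfB P 𝒜 n rB) (tOfB P 𝒜 n rB) c []).length) := by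
    rw [bpadF, Function.comp_apply, fanoutFn_apply, bpk0F_WB, Function.comp_apply, bnF_WB, polyFn_apply, dropFn_boolPair]
    simp [ones, List.drop_replicate]
  rw [bpkTF, fanoutFn_apply, fanoutFn_apply, bnF_WB, bpk0F_WB]
  simp only [Function.comp_apply, fanoutFn_apply, hpad, appF_boolPair, Kannan.zerosFn_apply, List.length_append, List.length_replicate]
  rw [pkT, padPk, two_mul]

/-- **`preB` computes the tree forger's input** `xH`. [folklore] -/
theorem preB_WB : preB P 𝒜 (WB n (P.S.keyGen.run n c).1 rB v) =
    xH P 𝒜 n (rOfB P 𝒜 n rB) (pkH P 𝒜 n (rOfB P 𝒜 n rB) (wOfB P 𝒜 n rB) (tOfB P 𝒜 n rB) c) := by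
  rw [preB, fanoutFn_apply, fanoutFn_apply, bnF_WB, bpkTF_WB, brAF_WB, xH, xA, Complexity.unaryEncodeNat_eq_replicate, ones]

/-- `bσF_WB` (bookkeeping). [folklore] -/
theorem bσF_WB (i : ℕ) (α : List Bool) : bσF P 𝒜 (boolPair (WB n pk rB v) (boolPair (unaryEncodeNat i) α)) = Yao.blk n i (ρD P 𝒜 n (rOfB P 𝒜 n rB)) := by
  rw [bσF]
  simp only [Function.comp_apply, fanoutFn_apply, fstF_boolPair, sndF_boolPair, bnF_WB, bρF_WB, ublkFn_apply]
  simp [onesFn, ones, Complexity.unaryEncodeNat_eq_replicate]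

/-- **`ansB` computes the hybrid signature of path `i`** (clip large enough): the record `⟨α, OFunI pkH sgH_v ρ i α⟩`.
[Goldreich 2004, proof of Prop. 6.4.15, Step 3] [folklore] -/
theorem ansB_WB {Pc : Polynomial ℕ} (i : ℕ) (α : List Bool)
    (hσ : (Yao.blk n i (ρD P 𝒜 n (rOfB P 𝒜 n rB))).length ≤ (boolPair (envB n (P.S.keyGen.run n c).1 rB v) α).length)
    (hshort : ∀ (cnt σ' pre acc : List Bool), σ' ≠ [] → pre ++ σ' = Yao.blk n i (ρD P 𝒜 n (rOfB P 𝒜 n rB)) →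
      (pieceZ (pkFB P 𝒜) (sgFB P 𝒜) (boolPair (boolPair (envB n (P.S.keyGen.run n c).1 rB v) α) (boolPair cnt (boolPair σ' (boolPair pre acc))))).length ≤
        Pc.eval (boolPair (envB n (P.S.keyGen.run n c).1 rB v) α).length) :
    ansB P 𝒜 Pc (boolPair (WB n (P.S.keyGen.run n c).1 rB v) (boolPair (unaryEncodeNat i) α)) =
      boolPair α (OFunI n (pkH P 𝒜 n (rOfB P 𝒜 n rB) (wOfB P 𝒜 n rB) (tOfB P 𝒜 n rB) c)
        (Function.update (sgNW P 𝒜 n (rOfB P 𝒜 n rB) (wOfB P 𝒜 n rB)) (Lslot P 𝒜 n (rOfB P 𝒜 n rB) (tOfB P 𝒜 n rB)) fun _ => v)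
        (ρD P 𝒜 n (rOfB P 𝒜 n rB)) i α) := by
  rw [ansB, fanoutFn_apply]
  simp only [Function.comp_apply, fanoutFn_apply, sndF_boolPair, fstF_boolPair, bsF_WB, bσF_WB]
  rw [chainFn_apply_prefix _ _ Pc _ α _ hσ hshort, OFunI, sigGI]
  simp only [pkFB_env, sgFB_env]

variable (P 𝒜)

/-- `bnF_mem_FP` (bookkeeping). [folklore] -/
theorem bnF_mem_FP : bnF ∈ FP := comp_mem_FP onesFn_mem_FP (comp_mem_FP fstF_mem_FP (comp_mem_FP fstF_mem_FP fstF_mem_FP))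
/-- `bsF_mem_FP` (bookkeeping). [folklore] -/
theorem bsF_mem_FP : bsF ∈ FP := fanoutFn_mem_FP bnF_mem_FP (PolyTimeComputable.id _)
/-- `brF_mem_FP` (bookkeeping). [folklore] -/
theorem brF_mem_FP : brF P 𝒜 ∈ FP := comp_mem_FP (srF_mem_FP P 𝒜) bsF_mem_FP
/-- `bρF_mem_FP` (bookkeeping). [folklore] -/
theorem bρF_mem_FP : bρF P 𝒜 ∈ FP := comp_mem_FP dropFn_mem_FP (fanoutFn_mem_FP (comp_mem_FP (polyFn_mem_FP _) bnF_mem_FP) (brF_mem_FP P 𝒜))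
/-- `brAF_mem_FP` (bookkeeping). [folklore] -/
theorem brAF_mem_FP : brAF P 𝒜 ∈ FP := comp_mem_FP takeFn_mem_FP (fanoutFn_mem_FP (comp_mem_FP (polyFn_mem_FP _) bnF_mem_FP) (brF_mem_FP P 𝒜))
/-- `bpk0F_mem_FP` (bookkeeping). [folklore] -/
theorem bpk0F_mem_FP (hK : P.S.keyGen.IsPolyTime unaryEncodeNat pairCode) : bpk0F P 𝒜 ∈ FP :=
  comp_mem_FP (pkFB_mem_FP P 𝒜 hK) (fanoutFn_mem_FP bsF_mem_FP (const_mem_FP _))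
/-- `bpkTF_mem_FP` (bookkeeping). [folklore] -/
theorem bpkTF_mem_FP (hK : P.S.keyGen.IsPolyTime unaryEncodeNat pairCode) : bpkTF P 𝒜 ∈ FP := by
  have hpad : bpadF P 𝒜 ∈ FP := comp_mem_FP dropFn_mem_FP (fanoutFn_mem_FP (bpk0F_mem_FP P 𝒜 hK) (comp_mem_FP (polyFn_mem_FP _) bnF_mem_FP))
  exact fanoutFn_mem_FP bnF_mem_FP (fanoutFn_mem_FP (bpk0F_mem_FP P 𝒜 hK) (comp_mem_FP Kannan.zerosFn_mem_FP (comp_mem_FP appF_mem_FP (fanoutFn_mem_FP hpad hpad))))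
/-- `preB_mem_FP` (bookkeeping). [folklore] -/
theorem preB_mem_FP (hK : P.S.keyGen.IsPolyTime unaryEncodeNat pairCode) : preB P 𝒜 ∈ FP :=
  fanoutFn_mem_FP (fanoutFn_mem_FP bnF_mem_FP (bpkTF_mem_FP P 𝒜 hK)) (brAF_mem_FP P 𝒜)
/-- `bσF_mem_FP` (bookkeeping). [folklore] -/
theorem bσF_mem_FP : bσF P 𝒜 ∈ FP := comp_mem_FP ublkFn_mem_FP (fanoutFn_mem_FP (comp_mem_FP bnF_mem_FP fstF_mem_FP)
  (fanoutFn_mem_FP (comp_mem_FP onesFn_mem_FP (comp_mem_FP fstF_mem_FP sndF_mem_FP)) (comp_mem_FP (bρF_mem_FP P 𝒜) fstF_mem_FP)))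
/-- `ansB_mem_FP` (bookkeeping). [folklore] -/
theorem ansB_mem_FP (hK : P.S.keyGen.IsPolyTime unaryEncodeNat pairCode) (hSg : P.S.sign.IsPolyTime pairCode id) (Pc : Polynomial ℕ) : ansB P 𝒜 Pc ∈ FP :=
  fanoutFn_mem_FP (comp_mem_FP sndF_mem_FP sndF_mem_FP) (comp_mem_FP (chainFn_mem_FP _ _ Pc (pkFB_mem_FP P 𝒜 hK) (sgFB_mem_FP P 𝒜 hK hSg))
    (fanoutFn_mem_FP (fanoutFn_mem_FP (comp_mem_FP bsF_mem_FP fstF_mem_FP) (comp_mem_FP sndF_mem_FP sndF_mem_FP)) (bσF_mem_FP P 𝒜)))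
/-- **`resB ∈ FP`.** [folklore] -/
theorem resB_mem_FP (h𝒜 : 𝒜.IsPPT ((encodingList Bool).pairBool (encodingList Bool))) (hK : P.S.keyGen.IsPolyTime unaryEncodeNat pairCode)
    (hSg : P.S.sign.IsPolyTime pairCode id) (Pc c R : Polynomial ℕ) : resB P 𝒜 Pc c R ∈ FP :=
  simFn_mem_FP (isPolyTime_EM 𝒜 h𝒜) (preB_mem_FP P 𝒜 hK) (ansB_mem_FP P 𝒜 hK hSg Pc) c R

end Emul

/-! ### The stages of the one-query forger -/

section Stages

variable (P 𝒜)

/-- `ρ` from the environment. [folklore] -/ noncomputable def sρF : List Bool → List Bool := dropFn ∘ fanoutFn (polyFn (cAPoly P 𝒜) ∘ snF) (srF P 𝒜)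
/-- The piece `⟨⟨1^{TA}, s⟩, 1ⁱ⟩ ↦ (blk n i ρ) ↾ |L_t|` of the first-use search. [folklore] -/ noncomputable def gprefF : List Bool → List Bool :=
  takeFn ∘ fanoutFn (sLtF P 𝒜 ∘ sndF ∘ fstF) (ublkFn ∘ fanoutFn (snF ∘ sndF ∘ fstF) (fanoutFn sndF (sρF P 𝒜 ∘ sndF ∘ fstF)))
/-- `listBool [(blk n i ρ) ↾ |L_t| : i < TA(n)]` from `W`. [folklore] -/ noncomputable def bprefsF : List Bool → List Bool :=
  tabulateFn (gprefF P 𝒜) 1 ∘ fanoutFn (polyFn (TAPoly P 𝒜) ∘ bnF) bsF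
/-- **`1^{firstUse}`**: the first query round through the planted label. [Goldreich 2004, proof of Prop. 6.4.15, Step 3] [folklore] -/
noncomputable def bfuF : List Bool → List Bool := firstIdxFn ∘ fanoutFn (sLtF P 𝒜 ∘ bsF) (bprefsF P 𝒜)
/-- The pass without the external answer: `W₀ = ⟨xr, ε⟩`. [folklore] -/ noncomputable def w0F : List Bool → List Bool := fanoutFn id fun _ => []
/-- **Used?** `[firstUse + 1 ≤ #records]` on `W`. [folklore] -/
noncomputable def usedF (Pc c R : Polynomial ℕ) : List Bool → List Bool :=
  lenLeFn X ∘ fanoutFn (fstF ∘ sndF ∘ resB P 𝒜 Pc c R) (List.cons true ∘ bfuF P 𝒜)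
/-- **The decision stage** `D_B`: query iff the planted node is used (in the pass without answer). [folklore] -/
noncomputable def DB (Pc c R : Polynomial ℕ) : List Bool → List Bool := usedF P 𝒜 Pc c R ∘ w0F
/-- The children pair of the planted label. [folklore] -/ noncomputable def bpairF : List Bool → List Bool :=
  fanoutFn (pkFB P 𝒜 ∘ fanoutFn bsF (appF ∘ fanoutFn (sLtF P 𝒜 ∘ bsF) fun _ => [false]))
    (pkFB P 𝒜 ∘ fanoutFn bsF (appF ∘ fanoutFn (sLtF P 𝒜 ∘ bsF) fun _ => [true]))
/-- The document of the first query through the planted leaf (pass without answer). [folklore] -/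
noncomputable def bleafMsgF (Pc c R : Polynomial ℕ) : List Bool → List Bool :=
  fstF ∘ nthItemFn ∘ fanoutFn (bfuF P 𝒜) (sndF ∘ sndF ∘ resB P 𝒜 Pc c R)
/-- `[|L_t| + 1 ≤ n]`: the planted label is internal. [folklore] -/ noncomputable def binternalF : List Bool → List Bool :=
  lenLeFn X ∘ fanoutFn bnF (List.cons true ∘ sLtF P 𝒜 ∘ bsF)
/-- **The message the planted node must sign**, on `W`. [Goldreich 2004, proof of Prop. 6.4.15, Step 3] [folklore] -/
noncomputable def mstarF (Pc c R : Polynomial ℕ) : List Bool → List Bool := iteFn (binternalF P 𝒜) (bpairF P 𝒜) (bleafMsgF P 𝒜 Pc c R)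
/-- **The query stage** `Q_B`. [folklore] -/
noncomputable def QB (Pc c R : Polynomial ℕ) : List Bool → List Bool := mstarF P 𝒜 Pc c R ∘ w0F
/-- The items of the forged signature. [folklore] -/ noncomputable def bitsF (Pc c R : Polynomial ℕ) : List Bool → List Bool := sndF ∘ sndF ∘ fstF ∘ resB P 𝒜 Pc c R
/-- The forged document. [folklore] -/ noncomputable def bαF (Pc c R : Polynomial ℕ) : List Bool → List Bool := fstF ∘ fstF ∘ resB P 𝒜 Pc c R
/-- `L_t L_t L_t` (a ruler of length `3 |L_t|`). [folklore] -/ noncomputable def b3F : List Bool → List Bool :=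
  appF ∘ fanoutFn (sLtF P 𝒜 ∘ bsF) (appF ∘ fanoutFn (sLtF P 𝒜 ∘ bsF) (sLtF P 𝒜 ∘ bsF))
/-- Item `3|L_t| + k` of the forged signature. [folklore] -/ noncomputable def bitemF (k : ℕ) (Pc c R : Polynomial ℕ) : List Bool → List Bool :=
  nthItemFn ∘ fanoutFn ((fun u => List.replicate k true ++ u) ∘ b3F P 𝒜) (bitsF P 𝒜 Pc c R)
/-- **The output stage**: the component of the forged signature at the planted level, `⟨m, β⟩`.
[Goldreich 2004, proof of Prop. 6.4.15, Step 4] [folklore] -/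
noncomputable def outB (Pc c R : Polynomial ℕ) : List Bool → List Bool :=
  iteFn (binternalF P 𝒜) (fanoutFn (fanoutFn (bitemF P 𝒜 0 Pc c R) (bitemF P 𝒜 1 Pc c R)) (bitemF P 𝒜 2 Pc c R))
    (fanoutFn (bαF P 𝒜 Pc c R) (bitemF P 𝒜 0 Pc c R))
/-- Output without asking. [folklore] -/ noncomputable def Out0B (Pc c R : Polynomial ℕ) : List Bool → List Bool := outB P 𝒜 Pc c R ∘ w0F
/-- Output from the answer (`⟨xr, v⟩` is already an emulation input). [folklore] -/ noncomputable def Out1B (Pc c R : Polynomial ℕ) : List Bool → List Bool := outB P 𝒜 Pc c R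

/-- The coins of the one-time forger: `r ‖ w ‖ tb`, generously `cD + fuelD·R + qD`. [folklore] -/
noncomputable def cBPoly : Polynomial ℕ := cDPoly P 𝒜 + mRPoly P 𝒜 + qD P 𝒜

/-- **The one-time forger `B`** of Goldreich's reduction (clip `Pc`, query cap `c`, rounds `R` of the emulation).
[Goldreich 2004, proof of Prop. 6.4.15 ("The construction of adversary `A`"); Prop. 6.4.17] [cite: Goldreich2004, Prop. 6.4.15] -/
noncomputable def forgerB (Pc c R : Polynomial ℕ) : OracleAdversary (List Bool × List Bool) :=
  ⟨oneQueryPair (DB P 𝒜 Pc c R) (QB P 𝒜 Pc c R) (Out0B P 𝒜 Pc c R) (Out1B P 𝒜 Pc c R), cBPoly P 𝒜, 2⟩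

variable {P 𝒜}

/-! #### Values -/

variable (n : ℕ) (pk rB v : List Bool)

/-- `sρF_env` (bookkeeping). [folklore] -/
theorem sρF_env : sρF P 𝒜 (envB n pk rB v) = ρD P 𝒜 n (rOfB P 𝒜 n rB) := by
  rw [sρF, Function.comp_apply, fanoutFn_apply, Function.comp_apply, snF_env, polyFn_apply, srF_env, dropFn_boolPair, ρD, cA_eq]
  simp [ones]

/-- The prefixes searched by `bfuF`. [folklore] -/
noncomputable def prefsOf (n T : ℕ) (ρ L : List Bool) : List (List Bool) := (List.range T).map fun i => (Yao.blk n i ρ).take L.length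

/-- `bprefsF_WB` (bookkeeping). [folklore] -/
theorem bprefsF_WB : bprefsF P 𝒜 (WB n pk rB v) =
    encList (prefsOf n (TA P 𝒜 n) (ρD P 𝒜 n (rOfB P 𝒜 n rB)) (Lslot P 𝒜 n (rOfB P 𝒜 n rB) (tOfB P 𝒜 n rB))) := by
  rw [bprefsF, Function.comp_apply, fanoutFn_apply, Function.comp_apply, bnF_WB, polyFn_apply, bsF_WB, tabulateFn_apply]
  · simp only [prefsOf, TA_eq, ones, List.length_replicate]
    refine congrArg encList (List.map_congr_left fun i _ => ?_)
    rw [gprefF]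
    simp only [Function.comp_apply, fanoutFn_apply, fstF_boolPair, sndF_boolPair, sLtF_env, snF_env, sρF_env, ublkFn_apply, takeFn_boolPair]
    simp [ones]
  · intro i _
    rw [gprefF]
    simp only [Function.comp_apply, fanoutFn_apply, fstF_boolPair, sndF_boolPair, sLtF_env, snF_env, sρF_env, ublkFn_apply, takeFn_boolPair,
      length_boolPair, List.length_take]
    have h1 : (Lslot P 𝒜 n (rOfB P 𝒜 n rB) (tOfB P 𝒜 n rB)).length ≤ n + 1 := by
      rw [Lslot]
      rcases Nat.eq_zero_or_pos n with rfl | hn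
      · simp only [labAt]; split_ifs <;> simp [Yao.blk]
      · exact (length_labAt_le n _ _ hn).trans (Nat.le_succ n)
    have h2 : 2 * n + 2 ≤ (envB n pk rB v).length := by simp [envB, length_boolPair, ones]
    simp only [List.length_replicate, ones]
    have h3 := min_le_left (Lslot P 𝒜 n (rOfB P 𝒜 n rB) (tOfB P 𝒜 n rB)).length (Yao.blk n i (ρD P 𝒜 n (rOfB P 𝒜 n rB))).length
    omega

/-- `bfuF_WB` (bookkeeping). [folklore] -/
theorem bfuF_WB : bfuF P 𝒜 (WB n pk rB v) =
    ones (firstIdx (Lslot P 𝒜 n (rOfB P 𝒜 n rB) (tOfB P 𝒜 n rB)) (prefsOf n (TA P 𝒜 n) (ρD P 𝒜 n (rOfB P 𝒜 n rB)) (Lslot P 𝒜 n (rOfB P 𝒜 n rB) (tOfB P 𝒜 n rB)))) := by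
  rw [bfuF, Function.comp_apply, fanoutFn_apply, Function.comp_apply, bsF_WB, sLtF_env, bprefsF_WB, firstIdxFn_apply]

/-- **`firstUse` is the first index of the planted label among the prefixes.** [folklore] -/
theorem firstUse_eq_firstIdx (n T : ℕ) (ρ L : List Bool) : firstUse n T ρ L = firstIdx L (prefsOf n T ρ L) := by
  classical
  have hlen : (prefsOf n T ρ L).length = T := by simp only [prefsOf, List.length_map, List.length_range]
  have hget : ∀ i (hi : i < (prefsOf n T ρ L).length), (prefsOf n T ρ L)[i] = (Yao.blk n i ρ).take L.length := by
    intro i hi; simp only [prefsOf, List.getElem_map, List.getElem_range]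
  have hmem : ∀ i, i < T → (Yao.blk n i ρ).take L.length ∈ prefsOf n T ρ L := by
    intro i hi
    rw [← hget i (by rw [hlen]; exact hi)]
    exact List.getElem_mem _
  unfold firstUse
  split_ifs with h
  · obtain ⟨hT, hpre⟩ := Nat.find_spec h
    apply le_antisymm
    · -- `Nat.find ≤ firstIdx`: the first index satisfies the predicate
      have hlt : firstIdx L (prefsOf n T ρ L) < (prefsOf n T ρ L).length := by
        have hm := hmem _ hT
        rw [hpre] at hm
        exact firstIdx_lt_length_of_mem hm
      refine Nat.find_min' h ⟨lt_of_lt_of_eq hlt hlen, ?_⟩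
      have := getElem_firstIdx L (prefsOf n T ρ L) hlt
      rwa [hget] at this
    · exact firstIdx_le_of_getElem L _ _ (by rw [hlen]; exact hT) (by rw [hget]; exact hpre)
  · -- no use: `firstIdx = T`
    have hle : firstIdx L (prefsOf n T ρ L) ≤ T := by have := firstIdx_le_length L (prefsOf n T ρ L); rwa [hlen] at this
    refine (le_antisymm hle ?_).symm
    by_contra hlt
    push Not at hlt
    have hlt' : firstIdx L (prefsOf n T ρ L) < (prefsOf n T ρ L).length := by rw [hlen]; exact hlt
    have := getElem_firstIdx L _ hlt'
    rw [hget] at this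
    exact h ⟨_, hlt, this⟩

/-- `w0F_apply` (bookkeeping). [folklore] -/
theorem w0F_apply (xr : List Bool) : w0F xr = boolPair xr [] := by simp [w0F]

/-- `binternalF_WB` (bookkeeping). [folklore] -/
theorem binternalF_WB : binternalF P 𝒜 (WB n pk rB v) = [decide ((Lslot P 𝒜 n (rOfB P 𝒜 n rB) (tOfB P 𝒜 n rB)).length < n)] := by
  rw [binternalF, Function.comp_apply, fanoutFn_apply, bnF_WB, Function.comp_apply, Function.comp_apply, bsF_WB, sLtF_env, lenLeFn_boolPair, eval_X,
    List.length_cons, ones, List.length_replicate]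
  rfl

variable {c : List Bool}

/-- `bpairF_WB` (bookkeeping). [folklore] -/
theorem bpairF_WB : bpairF P 𝒜 (WB n (P.S.keyGen.run n c).1 rB v) =
    pairMsg (pkH P 𝒜 n (rOfB P 𝒜 n rB) (wOfB P 𝒜 n rB) (tOfB P 𝒜 n rB) c) (Lslot P 𝒜 n (rOfB P 𝒜 n rB) (tOfB P 𝒜 n rB)) := by
  rw [bpairF, fanoutFn_apply, pairMsg]
  simp only [Function.comp_apply, fanoutFn_apply, bsF_WB, sLtF_env, appF_boolPair, pkFB_env]

/-- `b3F_WB` (bookkeeping). [folklore] -/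
theorem b3F_WB : b3F P 𝒜 (WB n pk rB v) =
    Lslot P 𝒜 n (rOfB P 𝒜 n rB) (tOfB P 𝒜 n rB) ++ (Lslot P 𝒜 n (rOfB P 𝒜 n rB) (tOfB P 𝒜 n rB) ++ Lslot P 𝒜 n (rOfB P 𝒜 n rB) (tOfB P 𝒜 n rB)) := by
  simp only [b3F, Function.comp_apply, fanoutFn_apply, bsF_WB, sLtF_env, appF_boolPair]

/-! #### Membership in `FP` -/

variable (P 𝒜)

/-- `sρF_mem_FP` (bookkeeping). [folklore] -/
theorem sρF_mem_FP : sρF P 𝒜 ∈ FP := comp_mem_FP dropFn_mem_FP (fanoutFn_mem_FP (comp_mem_FP (polyFn_mem_FP _) fstF_mem_FP) (srF_mem_FP P 𝒜))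
/-- `gprefF_mem_FP` (bookkeeping). [folklore] -/
theorem gprefF_mem_FP : gprefF P 𝒜 ∈ FP := comp_mem_FP takeFn_mem_FP (fanoutFn_mem_FP (comp_mem_FP (sLtF_mem_FP P 𝒜) (comp_mem_FP sndF_mem_FP fstF_mem_FP))
  (comp_mem_FP ublkFn_mem_FP (fanoutFn_mem_FP (comp_mem_FP fstF_mem_FP (comp_mem_FP sndF_mem_FP fstF_mem_FP))
    (fanoutFn_mem_FP sndF_mem_FP (comp_mem_FP (sρF_mem_FP P 𝒜) (comp_mem_FP sndF_mem_FP fstF_mem_FP))))))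
/-- `bprefsF_mem_FP` (bookkeeping). [folklore] -/
theorem bprefsF_mem_FP : bprefsF P 𝒜 ∈ FP :=
  comp_mem_FP (tabulateFn_mem_FP _ (gprefF_mem_FP P 𝒜) 1) (fanoutFn_mem_FP (comp_mem_FP (polyFn_mem_FP _) bnF_mem_FP) bsF_mem_FP)
/-- `bfuF_mem_FP` (bookkeeping). [folklore] -/
theorem bfuF_mem_FP : bfuF P 𝒜 ∈ FP := comp_mem_FP firstIdxFn_mem_FP (fanoutFn_mem_FP (comp_mem_FP (sLtF_mem_FP P 𝒜) bsF_mem_FP) (bprefsF_mem_FP P 𝒜))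
/-- `w0F_mem_FP` (bookkeeping). [folklore] -/
theorem w0F_mem_FP : w0F ∈ FP := fanoutFn_mem_FP (PolyTimeComputable.id _) (const_mem_FP _)

variable (h𝒜 : 𝒜.IsPPT ((encodingList Bool).pairBool (encodingList Bool))) (hK : P.S.keyGen.IsPolyTime unaryEncodeNat pairCode)
  (hSg : P.S.sign.IsPolyTime pairCode id) (Pc c R : Polynomial ℕ)

include h𝒜 hK hSg in
/-- `usedF_mem_FP` (bookkeeping). [folklore] -/
theorem usedF_mem_FP : usedF P 𝒜 Pc c R ∈ FP :=
  comp_mem_FP (lenLeFn_mem_FP X) (fanoutFn_mem_FP (comp_mem_FP fstF_mem_FP (comp_mem_FP sndF_mem_FP (resB_mem_FP P 𝒜 h𝒜 hK hSg Pc c R)))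
    (comp_mem_FP (cons_mem_FP true) (bfuF_mem_FP P 𝒜)))
include h𝒜 hK hSg in
/-- `DB_mem_FP` (bookkeeping). [folklore] -/
theorem DB_mem_FP : DB P 𝒜 Pc c R ∈ FP := comp_mem_FP (usedF_mem_FP P 𝒜 h𝒜 hK hSg Pc c R) w0F_mem_FP
/-- `oneBit_DB` (bookkeeping). [folklore] -/
theorem oneBit_DB : OneBit (DB P 𝒜 Pc c R) := fun z => by
  rcases lenLeFn_eq_or X (fanoutFn (fstF ∘ sndF ∘ resB P 𝒜 Pc c R) (List.cons true ∘ bfuF P 𝒜) (w0F z)) with h | h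
  · exact ⟨true, h⟩
  · exact ⟨false, h⟩
include hK in
/-- `bpairF_mem_FP` (bookkeeping). [folklore] -/
theorem bpairF_mem_FP : bpairF P 𝒜 ∈ FP :=
  fanoutFn_mem_FP (comp_mem_FP (pkFB_mem_FP P 𝒜 hK) (fanoutFn_mem_FP bsF_mem_FP (comp_mem_FP appF_mem_FP (fanoutFn_mem_FP (comp_mem_FP (sLtF_mem_FP P 𝒜) bsF_mem_FP) (const_mem_FP _)))))
    (comp_mem_FP (pkFB_mem_FP P 𝒜 hK) (fanoutFn_mem_FP bsF_mem_FP (comp_mem_FP appF_mem_FP (fanoutFn_mem_FP (comp_mem_FP (sLtF_mem_FP P 𝒜) bsF_mem_FP) (const_mem_FP _)))))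
include h𝒜 hK hSg in
/-- `bleafMsgF_mem_FP` (bookkeeping). [folklore] -/
theorem bleafMsgF_mem_FP : bleafMsgF P 𝒜 Pc c R ∈ FP :=
  comp_mem_FP fstF_mem_FP (comp_mem_FP nthItemFn_mem_FP (fanoutFn_mem_FP (bfuF_mem_FP P 𝒜) (comp_mem_FP sndF_mem_FP (comp_mem_FP sndF_mem_FP (resB_mem_FP P 𝒜 h𝒜 hK hSg Pc c R)))))
/-- `binternalF_mem_FP` (bookkeeping). [folklore] -/
theorem binternalF_mem_FP : binternalF P 𝒜 ∈ FP :=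
  comp_mem_FP (lenLeFn_mem_FP X) (fanoutFn_mem_FP bnF_mem_FP (comp_mem_FP (cons_mem_FP true) (comp_mem_FP (sLtF_mem_FP P 𝒜) bsF_mem_FP)))
include h𝒜 hK hSg in
/-- `mstarF_mem_FP` (bookkeeping). [folklore] -/
theorem mstarF_mem_FP : mstarF P 𝒜 Pc c R ∈ FP := iteFn_mem_FP (binternalF_mem_FP P 𝒜) (bpairF_mem_FP P 𝒜 hK) (bleafMsgF_mem_FP P 𝒜 h𝒜 hK hSg Pc c R)
include h𝒜 hK hSg in
/-- `QB_mem_FP` (bookkeeping). [folklore] -/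
theorem QB_mem_FP : QB P 𝒜 Pc c R ∈ FP := comp_mem_FP (mstarF_mem_FP P 𝒜 h𝒜 hK hSg Pc c R) w0F_mem_FP
include h𝒜 hK hSg in
/-- `bitsF_mem_FP` (bookkeeping). [folklore] -/
theorem bitsF_mem_FP : bitsF P 𝒜 Pc c R ∈ FP := comp_mem_FP sndF_mem_FP (comp_mem_FP sndF_mem_FP (comp_mem_FP fstF_mem_FP (resB_mem_FP P 𝒜 h𝒜 hK hSg Pc c R)))
include h𝒜 hK hSg in
/-- `bαF_mem_FP` (bookkeeping). [folklore] -/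
theorem bαF_mem_FP : bαF P 𝒜 Pc c R ∈ FP := comp_mem_FP fstF_mem_FP (comp_mem_FP fstF_mem_FP (resB_mem_FP P 𝒜 h𝒜 hK hSg Pc c R))
/-- `b3F_mem_FP` (bookkeeping). [folklore] -/
theorem b3F_mem_FP : b3F P 𝒜 ∈ FP := comp_mem_FP appF_mem_FP (fanoutFn_mem_FP (comp_mem_FP (sLtF_mem_FP P 𝒜) bsF_mem_FP)
  (comp_mem_FP appF_mem_FP (fanoutFn_mem_FP (comp_mem_FP (sLtF_mem_FP P 𝒜) bsF_mem_FP) (comp_mem_FP (sLtF_mem_FP P 𝒜) bsF_mem_FP))))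
include h𝒜 hK hSg in
/-- `bitemF_mem_FP` (bookkeeping). [folklore] -/
theorem bitemF_mem_FP (k : ℕ) : bitemF P 𝒜 k Pc c R ∈ FP := by
  have happ : (fun u : List Bool => List.replicate k true ++ u) ∈ FP := by
    induction k with
    | zero =>
      have : (fun u : List Bool => List.replicate 0 true ++ u) = id := by funext u; simp
      rw [this]; exact PolyTimeComputable.id _
    | succ k ih =>
      have : (fun u : List Bool => List.replicate (k + 1) true ++ u) = List.cons true ∘ fun u => List.replicate k true ++ u := by
        funext u; simp [List.replicate_succ]
      rw [this]; exact comp_mem_FP (cons_mem_FP true) ih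
  exact comp_mem_FP nthItemFn_mem_FP (fanoutFn_mem_FP (comp_mem_FP happ (b3F_mem_FP P 𝒜)) (bitsF_mem_FP P 𝒜 h𝒜 hK hSg Pc c R))
include h𝒜 hK hSg in
/-- `outB_mem_FP` (bookkeeping). [folklore] -/
theorem outB_mem_FP : outB P 𝒜 Pc c R ∈ FP :=
  iteFn_mem_FP (binternalF_mem_FP P 𝒜) (fanoutFn_mem_FP (fanoutFn_mem_FP (bitemF_mem_FP P 𝒜 h𝒜 hK hSg Pc c R 0) (bitemF_mem_FP P 𝒜 h𝒜 hK hSg Pc c R 1))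
    (bitemF_mem_FP P 𝒜 h𝒜 hK hSg Pc c R 2)) (fanoutFn_mem_FP (bαF_mem_FP P 𝒜 h𝒜 hK hSg Pc c R) (bitemF_mem_FP P 𝒜 h𝒜 hK hSg Pc c R 0))

/-- The outputs are pair codes. [folklore] -/
theorem outB_pair (z : List Bool) : boolPair (fstF (outB P 𝒜 Pc c R z)) (sndF (outB P 𝒜 Pc c R z)) = outB P 𝒜 Pc c R z := by
  unfold outB binternalF
  rw [iteFn_of_oneBit ((oneBit_lenLeFn' X).comp _)]
  split_ifs <;> simp [fanoutFn_apply]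
where
  /-- the length test is one bit -/
  oneBit_lenLeFn' (p : Polynomial ℕ) : OneBit (lenLeFn p) := fun w => by
    rcases lenLeFn_eq_or p w with h | h
    · exact ⟨true, h⟩
    · exact ⟨false, h⟩

include h𝒜 hK hSg in
/-- **The one-time forger is probabilistic polynomial-time** (given a PPT tree forger and an efficient one-time scheme).
[Goldreich 2004, proof of Prop. 6.4.15 ("adversary A is a probabilistic polynomial-time machine")] [cite: Goldreich2004, Prop. 6.4.15] -/
theorem isPPT_forgerB : (forgerB P 𝒜 Pc c R).IsPPT ((encodingList Bool).pairBool (encodingList Bool)) :=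
  isPolyTime_oneQueryPair _ _ _ _ (DB_mem_FP P 𝒜 h𝒜 hK hSg Pc c R) (oneBit_DB P 𝒜 Pc c R) (QB_mem_FP P 𝒜 h𝒜 hK hSg Pc c R)
    (comp_mem_FP (outB_mem_FP P 𝒜 h𝒜 hK hSg Pc c R) w0F_mem_FP) (outB_mem_FP P 𝒜 h𝒜 hK hSg Pc c R)
    (fun _ => outB_pair P 𝒜 Pc c R _) (fun z => outB_pair P 𝒜 Pc c R z)

end Stages

end TreeSig

end Literature.Computability.Cryptography
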